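import Literature.Geometry.Lorentzian.HypersurfaceNaturality
import Literature.Geometry.Lorentzian.CauchyDevelopmentRestrict
import Literature.Geometry.Lorentzian.OpensCausality
import Literature.Geometry.Riemannian.MaximalGeodesicRescaling
import HarnessLib

/-!
# Isometric immersions map geodesics to geodesics and commute with the exponential map

O'Neill, *Semi-Riemannian Geometry* (1983), Ch. 3, pp. 90–91 (local isometries preserve the
Levi-Civita connection, hence geodesics: *"if `γ` is a geodesic of `M` then `ψ ∘ γ` is a geodesic
of `N`"*, and `ψ ∘ exp_p = exp_{ψ p} ∘ dψ_p` on the domain of `exp_p`, proof of Prop. 3.62).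
This is the identity *"the exponential map commutes with isometries"* on which Sbierski's
extension of the isometric embedding of a common globally hyperbolic development across
corresponding boundary points rests (J. Sbierski, Ann. Henri Poincaré 17 (2016) 301–329 =
arXiv:1309.7591v3, §3.2, proof of Lemma 14: *"`ψ(q) = ψ(exp_{γ(-ε)}(X)) =
exp_{(ψ∘γ)(-ε)}(ψ_*(X))`"*). We prove, for `C^∞` pseudo-Riemannian metrics `gN`, `gM` on
equidimensional manifolds and an isometric immersion `f : (N, gN) → (M, gM)`
(`PseudoRiemannianMetric.IsIsometricImmersion`):

* `IsIsometricImmersion.eq_comap` — `gN = f^* gM` (`PseudoRiemannianMetric.comap`);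
* `PseudoRiemannianMetric.isGeodesicOn_comp_of_comap`, `IsIsometricImmersion.isGeodesicOn_comp`
  — **`f` maps geodesics to geodesics** (on open parameter sets), with velocity `df(ζ')`
  (naturality of the induced covariant derivative, `mfderiv_covariantDerivAlong_comap`,
  O'Neill Prop. 3.59);
* `IsIsometricImmersion.maximalGeodesic_comp`, `IsIsometricImmersion.expMap_comp` — **`f`
  commutes with the exponential map**: `dom γ_v ⊆ dom γ_{df v}`, `f ∘ γ_v = γ_{df v}` there, and
  `f (exp_y v) = exp_{f y} (df_y v)` for `v ∈ 𝓔_y`;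
* for an open sub-manifold `U ⊆ M` with the restricted metric `g|_U`
  (`PseudoRiemannianMetric.restrict`): `isGeodesicOn_restrict_iff` (**the geodesics of `U` are the
  geodesics of `M` lying in `U`**), `maximalGeodesic_restrict`, `expMap_restrict_of_mem`
  (`exp^U_y v = exp_y v` for `v ∈ 𝓔^U_y`) and the converse `mem_expDomain_restrict_of_forall`
  (**if the radial geodesic `t ↦ exp_y (t v)`, `t ∈ [0, 1]`, stays in `U` then `v ∈ 𝓔^U_y`**).

Everything is proved; no definitions, no named facts (D-0026).

## References

* B. O'Neill, *Semi-Riemannian geometry with applications to relativity*, Academic Press 1983,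
  Ch. 3, pp. 90–91, Prop. 3.59, proof of Prop. 3.62. [ONeillSemiRiemannian1983]
* J. Sbierski, Ann. Henri Poincaré 17 (2016) 301–329 = arXiv:1309.7591v3, §3.2, proof of
  Lemma 14 (arXiv numbering). [Sbierski2016AHP]
* J. M. Lee, *Introduction to Riemannian Manifolds*, 2nd ed., Springer 2018, Prop. 5.19,
  Cor. 4.28, Prop. 5.20 (naturality of `exp`). [LeeRiemannianManifolds2018]
-/

noncomputable section

open Bundle Set Filter Function TopologicalSpace
open scoped Manifold ContDiff Topology

namespace Literature.Geometry.Lorentzian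

open Literature.Geometry.Riemannian

/-! ### Isometric immersions between equidimensional manifolds -/

section General

variable {E : Type*} [NormedAddCommGroup E] [NormedSpace ℝ E] {H : Type*} [TopologicalSpace H]
  {I : ModelWithCorners ℝ E H} {M : Type*} [TopologicalSpace M] [ChartedSpace H M]
  [IsManifold I ∞ M]
  {E' : Type*} [NormedAddCommGroup E'] [NormedSpace ℝ E'] {H' : Type*} [TopologicalSpace H']
  {I' : ModelWithCorners ℝ E' H'} {N : Type*} [TopologicalSpace N] [ChartedSpace H' N]
  [IsManifold I' ∞ N]
  [FiniteDimensional ℝ E] [FiniteDimensional ℝ E'] [CompleteSpace E] [CompleteSpace E']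

namespace PseudoRiemannianMetric

omit [CompleteSpace E] in
/-- **Equidimensional immersions onto which a metric is pulled back map geodesics to geodesics**
(O'Neill 1983, Ch. 3, Prop. 3.59 with Prop. 3.18): for a smooth equidimensional immersion
`Φ : N → M`, a smooth metric `g` on `M` and a geodesic `ζ` of `Φ^* g` on an open parameter set `D`,
the curve `Φ ∘ ζ` is a geodesic of `g` on `D` with velocity `dΦ(ζ')`: its tangent lift is
`TΦ ∘ (tangent lift of ζ)` near each parameter of `D`, and
`D^g(Φ ∘ ζ)'/dt = dΦ (D^{Φ^*g} ζ'/dt) = 0` (`mfderiv_covariantDerivAlong_comap`).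
[cite: ONeillSemiRiemannian1983, Ch. 3, Prop. 3.59 and pp. 90–91] -/
theorem isGeodesicOn_comp_of_comap
    (g : PseudoRiemannianMetric I ∞ E (TangentSpace I : M → Type _)) [g.HasLeviCivita]
    {Φ : N → M} (hpb : contMDiff_pullbackBilin I M I' N ∞)
    (hΦ : ContMDiff I' I (∞ + 1) Φ) (hΦ' : ∀ u, Function.Injective (mfderiv I' I Φ u))
    (hdim : Module.finrank ℝ E' = Module.finrank ℝ E)
    [(g.comap hpb Φ hΦ hΦ' hdim).HasLeviCivita]
    {ζ : ℝ → N} {D : Set ℝ} (hD : IsOpen D)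
    (hζ : IsGeodesicOn (g.comap hpb Φ hΦ hΦ' hdim).leviCivita ζ D) :
    IsGeodesicOn g.leviCivita (Φ ∘ ζ) D ∧
      ∀ t ∈ D, velocity I (Φ ∘ ζ) t = mfderiv I' I Φ (ζ t) (velocity I' ζ t) := by
  -- adapted from Summits/…/StarvedNecksHonestFixedRadiusSettlingStubFlatZoneSojournTransport
  have hΦs : ContMDiff I' I ∞ Φ := hΦ.of_le le_self_add
  have hζd : ∀ t ∈ D, MDifferentiableAt 𝓘(ℝ, ℝ) I' ζ t := fun t ht ↦
    IsGeodesicOn.mdifferentiableAt_holds hζ ht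
  have hvel : ∀ t ∈ D, velocity I (Φ ∘ ζ) t = mfderiv I' I Φ (ζ t) (velocity I' ζ t) := by
    intro t ht
    simp only [velocity]
    rw [mfderiv_comp t ((hΦs _).mdifferentiableAt (by simp)) (hζd t ht)]
    rfl
  have hlift : ∀ t ∈ D, tangentLift I (Φ ∘ ζ) t = tangentMap I' I Φ (tangentLift I' ζ t) := by
    intro t ht
    exact TotalSpace.ext rfl (heq_of_eq (hvel t ht))
  have hev : ∀ t ∈ D, tangentLift I (Φ ∘ ζ) =ᶠ[𝓝 t] (tangentMap I' I Φ ∘ tangentLift I' ζ) :=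
    fun t ht ↦ Filter.eventuallyEq_of_mem (hD.mem_nhds ht) fun t' ht' ↦ hlift t' ht'
  refine ⟨⟨fun t ht ↦ ?_, fun t ht ↦ ?_⟩, hvel⟩
  · have htm : ContMDiff I'.tangent I.tangent ∞ (tangentMap I' I Φ) :=
      hΦ.contMDiff_tangentMap le_rfl
    exact (((htm _).mdifferentiableAt (by simp)).comp t (hζ.1 t ht)).congr_of_eventuallyEq
      (hev t ht)
  · have key := g.mfderiv_covariantDerivAlong_comap hpb hΦ hΦ' hdim (γ := ζ)
      (W := fun t ↦ velocity I' ζ t) (t₀ := t) (hζ.1 t ht)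
    rw [hζ.2 t ht, map_zero] at key
    rw [covariantDerivAlong_congr_of_eventuallyEq g.leviCivita (γ := Φ ∘ ζ)
      (W := fun t ↦ mfderiv I' I Φ (ζ t) (velocity I' ζ t)) (hev t ht)]
    exact key.symm

omit [FiniteDimensional ℝ E] [CompleteSpace E] in
/-- The Levi-Civita connections of equal metrics are equal (whatever the proofs of the standing
Levi-Civita hypothesis). [folklore] -/
theorem leviCivita_congr_metric {n : ℕ∞ω}
    {g₁ g₂ : PseudoRiemannianMetric I n E (TangentSpace I : M → Type _)} (h : g₁ = g₂)
    [i₁ : g₁.HasLeviCivita] [i₂ : g₂.HasLeviCivita] :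
    g₁.leviCivita = g₂.leviCivita := by
  subst h; rfl

variable {gN : PseudoRiemannianMetric I' ∞ E' (TangentSpace I' : N → Type _)}
  {gM : PseudoRiemannianMetric I ∞ E (TangentSpace I : M → Type _)} {f : N → M}

namespace IsIsometricImmersion

omit [FiniteDimensional ℝ E] [FiniteDimensional ℝ E'] [CompleteSpace E] [CompleteSpace E'] in
/-- **The differential of an isometric immersion is injective** (nondegeneracy of the source
metric: `gN(v, w) = gM(df v, df w) = 0` for all `w` if `df v = 0`). O'Neill 1983, Ch. 3, p. 58.
[cite: ONeillSemiRiemannian1983, Ch. 3, p. 58] -/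
theorem injective_mfderiv (hf : IsIsometricImmersion gN gM f) (y : N) :
    Function.Injective (mfderiv I' I f y) := by
  refine (injective_iff_map_eq_zero _).2 fun v hv ↦ gN.nondegenerate y v fun w ↦ ?_
  have h := DFunLike.congr_fun (DFunLike.congr_fun (hf.2 y) v) w
  rw [pullbackBilin_apply, hv, map_zero] at h
  exact h.symm

omit [FiniteDimensional ℝ E] [FiniteDimensional ℝ E'] [CompleteSpace E] [CompleteSpace E'] in
/-- An isometric immersion of `C^∞` metrics is `C^{∞+1} = C^∞`. [folklore] -/
theorem contMDiff_add_one (hf : IsIsometricImmersion gN gM f) : ContMDiff I' I (∞ + 1) f := by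
  have h : (∞ : ℕ∞ω) + 1 = ∞ := by
    show ((⊤ : ℕ∞) : ℕ∞ω) + 1 = ((⊤ : ℕ∞) : ℕ∞ω)
    rw [← WithTop.coe_one, ← WithTop.coe_add, WithTop.coe_eq_coe]
    exact top_add _
  rw [h]
  exact hf.1

omit [CompleteSpace E] [CompleteSpace E'] in
/-- **`gN = f^* gM` for an isometric immersion `f : (N, gN) → (M, gM)` between equidimensional
manifolds** (the defining identity `gM(df v, df w) = gN(v, w)`, as an equality of metrics with
the pullback metric `PseudoRiemannianMetric.comap`). O'Neill 1983, Ch. 3, pp. 90–91.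
[cite: ONeillSemiRiemannian1983, Ch. 3, pp. 90–91] -/
theorem eq_comap (hf : IsIsometricImmersion gN gM f)
    (hdim : Module.finrank ℝ E' = Module.finrank ℝ E) (hfs : ContMDiff I' I (∞ + 1) f)
    (hf' : ∀ y, Function.Injective (mfderiv I' I f y)) :
    gN = gM.comap contMDiff_pullbackBilin_holds f hfs hf' hdim :=
  PseudoRiemannianMetric.ext (funext fun y ↦ (hf.2 y).symm)

omit [CompleteSpace E] in
/-- **Isometric immersions map geodesics to geodesics** (O'Neill 1983, Ch. 3, pp. 90–91: *"if
`γ` is a geodesic of `M` then `ψ ∘ γ` is a geodesic"*): for an isometric immersion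
`f : (N, gN) → (M, gM)` between equidimensional manifolds and a geodesic `ζ` of `gN` on an open
parameter set `D`, the curve `f ∘ ζ` is a geodesic of `gM` on `D` with velocity `df(ζ')`.
[cite: ONeillSemiRiemannian1983, Ch. 3, pp. 90–91 and Prop. 3.59] -/
theorem isGeodesicOn_comp [gN.HasLeviCivita] [gM.HasLeviCivita]
    (hf : IsIsometricImmersion gN gM f) (hdim : Module.finrank ℝ E' = Module.finrank ℝ E)
    {ζ : ℝ → N} {D : Set ℝ} (hD : IsOpen D) (hζ : IsGeodesicOn gN.leviCivita ζ D) :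
    IsGeodesicOn gM.leviCivita (f ∘ ζ) D ∧
      ∀ t ∈ D, velocity I (f ∘ ζ) t = mfderiv I' I f (ζ t) (velocity I' ζ t) := by
  have hfs := hf.contMDiff_add_one
  have hf' := hf.injective_mfderiv
  have h := hf.eq_comap hdim hfs hf'
  subst h
  exact isGeodesicOn_comp_of_comap gM contMDiff_pullbackBilin_holds hfs hf' hdim hD hζ

variable [T2Space N] [T2Space M] [BoundarylessManifold I' N] [BoundarylessManifold I M]

/-- **Isometric immersions commute with maximal geodesics**: for `f : (N, gN) → (M, gM)` an
isometric immersion between equidimensional manifolds, `y ∈ N` and `v ∈ T_y N`, the domain of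
the maximal geodesic `γ_v` of `N` is contained in that of the maximal geodesic `γ_{df v}` of `M`,
and `f ∘ γ_v = γ_{df v}` there (`f ∘ γ_v` is a geodesic with initial data `(f y, df_y v)`).
O'Neill 1983, Ch. 3, pp. 90–91. [cite: ONeillSemiRiemannian1983, Ch. 3, pp. 90–91] -/
theorem maximalGeodesic_comp [gN.HasLeviCivita] [gM.HasLeviCivita]
    [CovariantDerivative.ContMDiffCovariantDerivative gN.leviCivita 1]
    [CovariantDerivative.ContMDiffCovariantDerivative gM.leviCivita 1]
    (hf : IsIsometricImmersion gN gM f) (hdim : Module.finrank ℝ E' = Module.finrank ℝ E)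
    (y : N) (v : TangentSpace I' y) :
    maximalGeodesicDomain gN.leviCivita y v ⊆
        maximalGeodesicDomain gM.leviCivita (f y) (mfderiv I' I f y v) ∧
      EqOn (f ∘ maximalGeodesic gN.leviCivita y v)
        (maximalGeodesic gM.leviCivita (f y) (mfderiv I' I f y v))
        (maximalGeodesicDomain gN.leviCivita y v) := by
  obtain ⟨hmax, h0, hy0, hv0⟩ := maximalGeodesic_spec' (cov := gN.leviCivita) y v
  obtain ⟨hgeo, hvel⟩ := hf.isGeodesicOn_comp hdim hmax.isOpen hmax.isGeodesicOn
  refine subset_maximalGeodesicDomain_of_isGeodesicOn hmax.isOpen hmax.2.1 h0 hgeo ?_ ?_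
  · simp only [comp_apply, hy0]
  · rw [hvel 0 h0, hv0, hy0]

/-- **Isometric immersions commute with the exponential map** (O'Neill 1983, Ch. 3, proof of
Prop. 3.62: `ψ ∘ exp_p = exp_{ψ p} ∘ dψ_p`; Sbierski 2016, §3.2, proof of Lemma 14: *"the
exponential map commutes with isometries"*): for `v ∈ 𝓔_y`, `df_y v ∈ 𝓔_{f y}` and
`exp_{f y} (df_y v) = f (exp_y v)`. [cite: Sbierski2016AHP, §3.2, proof of Lemma 14 (arXiv numbering)] -/
theorem expMap_comp [gN.HasLeviCivita] [gM.HasLeviCivita]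
    [CovariantDerivative.ContMDiffCovariantDerivative gN.leviCivita 1]
    [CovariantDerivative.ContMDiffCovariantDerivative gM.leviCivita 1]
    (hf : IsIsometricImmersion gN gM f) (hdim : Module.finrank ℝ E' = Module.finrank ℝ E)
    {y : N} {v : TangentSpace I' y} (hv : v ∈ expDomain gN.leviCivita y) :
    mfderiv I' I f y v ∈ expDomain gM.leviCivita (f y) ∧
      expMap gM.leviCivita (f y) (mfderiv I' I f y v) = f (expMap gN.leviCivita y v) := by
  obtain ⟨hsub, heq⟩ := hf.maximalGeodesic_comp hdim y v
  have h1 : (1 : ℝ) ∈ maximalGeodesicDomain gN.leviCivita y v := hv.2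
  obtain ⟨hmem, hexp⟩ := expMap_smul_of_mem (cov := gM.leviCivita) (f y) (mfderiv I' I f y v)
    (hsub h1)
  rw [one_smul] at hmem hexp
  refine ⟨hmem, ?_⟩
  rw [hexp, ← heq h1, comp_apply, expMap_of_mem hv]

end IsIsometricImmersion

end PseudoRiemannianMetric

end General

/-! ### Geodesics and the exponential map of an open sub-manifold -/

section Opens

variable {d : ℕ} {M : Type*} [TopologicalSpace M] [ChartedSpace (EuclideanSpace ℝ (Fin d)) M]
  [IsManifold (𝓡 d) ∞ M]
  (g : PseudoRiemannianMetric (𝓡 d) ∞ (EuclideanSpace ℝ (Fin d)) (TangentSpace (𝓡 d) : M → Type _))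
  (U : Opens M)

namespace PseudoRiemannianMetric

/-- The inclusion of an open sub-manifold is an isometric immersion `(U, g|_U) → (M, g)`
(`d(Subtype.val) = id`). O'Neill 1983, Ch. 3, p. 57. [cite: ONeillSemiRiemannian1983, Ch. 3, p. 57] -/
theorem isIsometricImmersion_subtypeVal_restrict :
    IsIsometricImmersion (g.restrict contMDiff_restrict_holds U) g (Subtype.val : U → M) := by
  refine ⟨contMDiff_subtype_val, fun y ↦ ?_⟩
  ext v w
  rw [pullbackBilin_apply, mfderiv_subtypeVal]
  rfl

/-- **The geodesics of an open sub-manifold `(U, g|_U)` are the geodesics of `(M, g)` lying in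
`U`**: a curve `γ : ℝ → U` is a geodesic of `g|_U` on an open parameter set `D` iff `Subtype.val ∘ γ`
is a geodesic of `g` on `D` (`T_p U = T_p M`, and the Levi-Civita connection of `g|_U = ι^* g` is
computed by the naturality `mfderiv_covariantDerivAlong_comap` with `dι = id`). O'Neill 1983,
Ch. 3, p. 57 and pp. 90–91. [cite: ONeillSemiRiemannian1983, Ch. 3, pp. 90–91] -/
theorem isGeodesicOn_restrict_iff [g.HasLeviCivita]
    [(g.restrict contMDiff_restrict_holds U).HasLeviCivita] {γ : ℝ → U} {D : Set ℝ}
    (hD : IsOpen D) :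
    IsGeodesicOn (g.restrict contMDiff_restrict_holds U).leviCivita γ D ↔
      IsGeodesicOn g.leviCivita (Subtype.val ∘ γ) D := by
  refine ⟨fun h ↦ ((isIsometricImmersion_subtypeVal_restrict g U).isGeodesicOn_comp rfl hD h).1,
    fun h ↦ ?_⟩
  -- the restricted metric is the pullback along the inclusion
  set gc := g.comap contMDiff_pullbackBilin_holds (Subtype.val : U → M) contMDiff_subtype_val
    (injective_mfderiv_subtypeVal U) rfl with hgc_def
  haveI hgcLC : gc.HasLeviCivita := gc.hasLeviCivita
  have hgc : g.restrict contMDiff_restrict_holds U = gc := restrict_eq_comap g U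
  rw [leviCivita_congr_metric hgc]
  -- velocities agree
  have hvel : ∀ t, (velocity (𝓡 d) (Subtype.val ∘ γ) t : EuclideanSpace ℝ (Fin d)) =
      velocity (𝓡 d) γ t := fun t ↦ velocity_subtypeVal_comp U γ t
  have hliftfun : (fun t ↦ (TotalSpace.mk' (EuclideanSpace ℝ (Fin d)) ((γ t : U) : M)
      (velocity (𝓡 d) γ t) : TangentBundle (𝓡 d) M)) = tangentLift (𝓡 d) (Subtype.val ∘ γ) := by
    funext t
    exact TotalSpace.ext rfl (heq_of_eq (hvel t).symm)
  have hlift : ∀ t ∈ D, MDifferentiableAt 𝓘(ℝ, ℝ) (𝓡 d).tangent (tangentLift (𝓡 d) γ) t := by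
    intro t ht
    have h1 := h.1 t ht
    rw [← hliftfun] at h1
    exact (mdifferentiableAt_totalSpace_opens_iff U (b := γ) (s := fun t ↦ velocity (𝓡 d) γ t)).2 h1
  refine ⟨hlift, fun t ht ↦ ?_⟩
  have key := g.mfderiv_covariantDerivAlong_comap contMDiff_pullbackBilin_holds
    contMDiff_subtype_val (injective_mfderiv_subtypeVal U) rfl (γ := γ)
    (W := fun t ↦ velocity (𝓡 d) γ t) (t₀ := t) (hlift t ht)
  rw [mfderiv_subtypeVal] at key
  have hW : (fun t ↦ mfderiv (𝓡 d) (𝓡 d) (Subtype.val : U → M) (γ t) (velocity (𝓡 d) γ t)) =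
      fun t ↦ velocity (𝓡 d) (Subtype.val ∘ γ) t := by
    funext t
    rw [mfderiv_subtypeVal, hvel t]
    rfl
  rw [hW, h.2 t ht] at key
  exact key

variable [T2Space M]

/-- **The maximal geodesics of an open sub-manifold are restrictions of those of the ambient
manifold**: for `y ∈ U` and `v ∈ T_y U = T_y M`, `dom γ^U_v ⊆ dom γ_v` and `γ^U_v = γ_v` there.
O'Neill 1983, Ch. 3, pp. 57, 68. [cite: ONeillSemiRiemannian1983, Ch. 3, pp. 90–91] -/
theorem maximalGeodesic_restrict [g.HasLeviCivita]
    [(g.restrict contMDiff_restrict_holds U).HasLeviCivita]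
    [CovariantDerivative.ContMDiffCovariantDerivative g.leviCivita 1]
    [CovariantDerivative.ContMDiffCovariantDerivative
      (g.restrict contMDiff_restrict_holds U).leviCivita 1]
    (y : U) (v : TangentSpace (𝓡 d) y) :
    maximalGeodesicDomain (g.restrict contMDiff_restrict_holds U).leviCivita y v ⊆
        maximalGeodesicDomain g.leviCivita (y : M) v ∧
      EqOn (Subtype.val ∘ maximalGeodesic (g.restrict contMDiff_restrict_holds U).leviCivita y v)
        (maximalGeodesic g.leviCivita (y : M) v)
        (maximalGeodesicDomain (g.restrict contMDiff_restrict_holds U).leviCivita y v) := by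
  have h := (isIsometricImmersion_subtypeVal_restrict g U).maximalGeodesic_comp rfl y v
  rw [mfderiv_subtypeVal] at h
  exact h

/-- **`exp^U_y v = exp_y v` for `v ∈ 𝓔^U_y`**: the exponential map of an open sub-manifold is the
restriction of the exponential map of the ambient manifold. O'Neill 1983, Ch. 3, pp. 90–91.
[cite: ONeillSemiRiemannian1983, Ch. 3, pp. 90–91] -/
theorem expMap_restrict_of_mem [g.HasLeviCivita]
    [(g.restrict contMDiff_restrict_holds U).HasLeviCivita]
    [CovariantDerivative.ContMDiffCovariantDerivative g.leviCivita 1]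
    [CovariantDerivative.ContMDiffCovariantDerivative
      (g.restrict contMDiff_restrict_holds U).leviCivita 1]
    {y : U} {v : TangentSpace (𝓡 d) y}
    (hv : v ∈ expDomain (g.restrict contMDiff_restrict_holds U).leviCivita y) :
    v ∈ expDomain g.leviCivita (y : M) ∧
      ((expMap (g.restrict contMDiff_restrict_holds U).leviCivita y v : U) : M) =
        expMap g.leviCivita (y : M) v := by
  have h := (isIsometricImmersion_subtypeVal_restrict g U).expMap_comp rfl hv
  rw [mfderiv_subtypeVal] at h
  exact ⟨h.1, h.2.symm⟩

/-- **If the radial geodesic stays in `U`, its initial velocity lies in the domain of `exp^U`**: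
for `y ∈ U` and `v ∈ 𝓔_y` with `exp_y (t v) ∈ U` for all `t ∈ [0, 1]`, one has `v ∈ 𝓔^U_y` and
`exp^U_y v = exp_y v`. (The component of `0` in `{t ∈ dom γ_v | γ_v t ∈ U}` is an open interval
containing `[0, 1]` on which `γ_v`, read in `U`, is a geodesic of `g|_U` with initial data
`(y, v)` — hence a restriction of `γ^U_v`.) O'Neill 1983, Ch. 3, pp. 90–91; Sbierski 2016, §3.2,
proof of Lemma 14. [cite: Sbierski2016AHP, §3.2, proof of Lemma 14 (arXiv numbering)] -/
theorem mem_expDomain_restrict_of_forall [g.HasLeviCivita]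
    [(g.restrict contMDiff_restrict_holds U).HasLeviCivita]
    [CovariantDerivative.ContMDiffCovariantDerivative g.leviCivita 1]
    [CovariantDerivative.ContMDiffCovariantDerivative
      (g.restrict contMDiff_restrict_holds U).leviCivita 1]
    {y : U} {v : TangentSpace (𝓡 d) (y : M)} (hv : v ∈ expDomain g.leviCivita (y : M))
    (hU : ∀ t ∈ Icc (0 : ℝ) 1, expMap g.leviCivita (y : M) (t • v) ∈ U) :
    (v : TangentSpace (𝓡 d) y) ∈ expDomain (g.restrict contMDiff_restrict_holds U).leviCivita y ∧
      ((expMap (g.restrict contMDiff_restrict_holds U).leviCivita y v : U) : M) =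
        expMap g.leviCivita (y : M) v := by
  classical
  obtain ⟨hmax, h0, hy0, hv0⟩ := maximalGeodesic_spec' (cov := g.leviCivita) (y : M) v
  set γ := maximalGeodesic g.leviCivita (y : M) v with hγ_def
  set D₀ := maximalGeodesicDomain g.leviCivita (y : M) v with hD₀_def
  -- `γ` is continuous on `D₀`
  have hγc : ContinuousOn γ D₀ := fun t ht ↦
    (IsGeodesicOn.mdifferentiableAt_holds hmax.isGeodesicOn ht).continuousAt.continuousWithinAt
  -- the open set of good parameters and the component of `0`
  set A : Set ℝ := D₀ ∩ γ ⁻¹' (U : Set M) with hA_def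
  have hAo : IsOpen A := hγc.isOpen_inter_preimage hmax.isOpen U.2
  have h0A : (0 : ℝ) ∈ A := ⟨h0, by show γ 0 ∈ (U : Set M); rw [hy0]; exact y.2⟩
  set J : Set ℝ := connectedComponentIn A 0 with hJ_def
  have hJo : IsOpen J := hAo.connectedComponentIn
  have hJA : J ⊆ A := connectedComponentIn_subset A 0
  have hJc : J.OrdConnected :=
    isPreconnected_iff_ordConnected.1 isPreconnected_connectedComponentIn
  have h0J : (0 : ℝ) ∈ J := mem_connectedComponentIn h0A
  -- `[0, 1] ⊆ J`
  have h1D₀ : (1 : ℝ) ∈ D₀ := hv.2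
  have hIccD₀ : Icc (0 : ℝ) 1 ⊆ D₀ := hmax.2.1.out h0 h1D₀
  have hIccA : Icc (0 : ℝ) 1 ⊆ A := fun t ht ↦ ⟨hIccD₀ ht, by
    show γ t ∈ (U : Set M)
    rw [hγ_def, ← (expMap_smul_of_mem (cov := g.leviCivita) (y : M) v (hIccD₀ ht)).2]
    exact hU t ht⟩
  have hIccJ : Icc (0 : ℝ) 1 ⊆ J :=
    (isPreconnected_Icc).subset_connectedComponentIn (left_mem_Icc.2 zero_le_one) hIccA
  have h1J : (1 : ℝ) ∈ J := hIccJ (right_mem_Icc.2 zero_le_one)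
  -- the lift of `γ` to `U` on `J`
  set γU : ℝ → U := fun t ↦ if h : γ t ∈ (U : Set M) then ⟨γ t, h⟩ else y with hγU_def
  have hγU_val : ∀ t ∈ J, (γU t : M) = γ t := by
    intro t ht
    have hmem : γ t ∈ (U : Set M) := (hJA ht).2
    simp only [hγU_def, dif_pos hmem]
  have hev : ∀ t ∈ J, (Subtype.val ∘ γU) =ᶠ[𝓝 t] γ := fun t ht ↦
    Filter.eventuallyEq_of_mem (hJo.mem_nhds ht) fun t' ht' ↦ hγU_val t' ht'
  -- it is a geodesic of `g|_U` on `J`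
  have hgeoM : IsGeodesicOn g.leviCivita (Subtype.val ∘ γU) J :=
    IsGeodesicOn.congr_holds (hmax.isGeodesicOn.mono (hJA.trans inter_subset_left)) hJo
      fun t ht ↦ (hγU_val t ht).symm
  have hgeoU : IsGeodesicOn (g.restrict contMDiff_restrict_holds U).leviCivita γU J :=
    (isGeodesicOn_restrict_iff g U hJo).2 hgeoM
  have hγU0 : γU 0 = y := Subtype.ext (by rw [hγU_val 0 h0J, hy0])
  have hγUv : velocity (𝓡 d) γU 0 = (v : TangentSpace (𝓡 d) y) := by
    have h1 : (velocity (𝓡 d) (Subtype.val ∘ γU) 0 : EuclideanSpace ℝ (Fin d)) =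
        velocity (𝓡 d) γU 0 := velocity_subtypeVal_comp U γU 0
    have h2 : velocity (𝓡 d) (Subtype.val ∘ γU) 0 = velocity (𝓡 d) γ 0 :=
      velocity_congr_of_eventuallyEq (hev 0 h0J)
    rw [← h1, h2, hv0]
  obtain ⟨hsub, heq⟩ := subset_maximalGeodesicDomain_of_isGeodesicOn hJo hJc h0J hgeoU hγU0 hγUv
  obtain ⟨hmem, hexp⟩ := expMap_smul_of_mem
    (cov := (g.restrict contMDiff_restrict_holds U).leviCivita) y (v : TangentSpace (𝓡 d) y)
    (hsub h1J)
  rw [one_smul] at hmem hexp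
  refine ⟨hmem, ?_⟩
  rw [hexp, ← heq h1J, hγU_val 1 h1J, hγ_def,
    ← (expMap_smul_of_mem (cov := g.leviCivita) (y : M) v h1D₀).2, one_smul]

end PseudoRiemannianMetric

end Opens

end Literature.Geometry.Lorentzian

end
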